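import Summits.ResolutionOfSingularities.ResolutionOfSingularities.Theorems.WallFrames2
import Summits.ResolutionOfSingularities.ResolutionOfSingularities.Theorems.NearCutCompanion3
import Summits.ResolutionOfSingularities.ResolutionOfSingularities.Theorems.NearCutWalls2
import Summits.ResolutionOfSingularities.ResolutionOfSingularities.Theorems.ProximityCutArcLaw
import Summits.ResolutionOfSingularities.ResolutionOfSingularities.Theorems.MaxContactCutBoundaryLedger
import Summits.ResolutionOfSingularities.ResolutionOfSingularities.Theorems.MaxContactCutWallCut
import Summits.ResolutionOfSingularities.ResolutionOfSingularities.Theorems.PlanarGhostDescent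
import Literature.AlgebraicGeometry.Resolution.PointBlowupIFPGiraud
import Literature.AlgebraicGeometry.Resolution.AdicNoetherian
import HarnessLib

/-!
# WallFrames (3/17) — Kollár's wall descent in a polynomial frame; sections: Transport (cont.), FreeChart, Jets

Verbatim slice of the farm-checked monolith `WallFrames.lean` of cell `decomp-res`, seat `decomp-res-lens-5`, g35
(sha256 7405a21d81d102a4…, monolith lines 600–824); one namespace `Summit.ResolutionOfSingularities.ResolutionOfSingularities.Theorems.WallFrames` across the
slices, imports chained.  The monolith's module docstring (laws W1–W7, mechanism, novelty, honest placement) is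
reproduced in slice 1; the main theorem `balancedWallPort_holds : WallCut.BalancedWallPort` (hypothesis-free) and the
host-route corollary `ecBalancedWallPort_holds` (aside item 27368 of route MaxContactCut) are in slice 16/17.
-/

open MvPolynomial Finset
open scoped BigOperators
open Literature.AlgebraicGeometry.Resolution
open Literature.AlgebraicGeometry.Resolution.Hauser2010
open Literature.AlgebraicGeometry.Resolution.PointBlowup
open Literature.AlgebraicGeometry.Resolution.HauserPerlega2024

namespace Summit.ResolutionOfSingularities.ResolutionOfSingularities.Theorems.WallFrames

variable {σ : Type*} [Fintype σ] [DecidableEq σ] {K : Type*} [Field K]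

section Transport

variable {z j : σ}

omit [Fintype σ] [DecidableEq σ] in
/-- **FAR PARTS AS A MONOMIAL IDEAL.**  "Every exponent of `R` has wall-degree `≥ Λ`" is membership in the monomial
ideal spanned by the exponents of wall-degree `≥ Λ` — so far parts are closed under sums and under multiplication by
anything (support form ↔ ideal form). [folklore] -/
theorem mem_span_far_iff {z : σ} {Λ : ℕ} {R : MvPolynomial σ K} :
    R ∈ Ideal.span ((fun m => monomial m (1 : K)) '' {m : σ →₀ ℕ | Λ + m z ≤ m.degree}) ↔
      ∀ d ∈ R.support, Λ + d z ≤ d.degree := by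
  rw [MvPolynomial.mem_ideal_span_monomial_image]
  constructor
  · intro h d hd
    obtain ⟨m, hm, hmd⟩ := h d hd
    have hm' : Λ + m z ≤ m.degree := hm
    have h1 : m.degree + (d - m).degree = d.degree := by rw [← map_add, add_tsub_cancel_of_le hmd]
    have h2 : (d - m) z ≤ (d - m).degree := Finsupp.le_degree z _
    have h3 : (d - m) z = d z - m z := Finsupp.tsub_apply _ _ _
    have h4 : m z ≤ d z := hmd z
    omega
  · intro h d hd
    exact ⟨d, h d hd, le_rfl⟩

omit [Fintype σ] [DecidableEq σ] in
/-- Far parts form an IDEAL: any multiple of a far polynomial is far (used for the `(r_g)`-remainders of the free-chart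
presentation law and for unit re-weightings). [folklore] -/
theorem far_mul {z : σ} {Λ : ℕ} {R : MvPolynomial σ K} (hR : ∀ d ∈ R.support, Λ + d z ≤ d.degree)
    (P : MvPolynomial σ K) : ∀ d ∈ (P * R).support, Λ + d z ≤ d.degree :=
  mem_span_far_iff.mp (Ideal.mul_mem_left _ P (mem_span_far_iff.mpr hR))

omit [Fintype σ] in
/-- The lost-wall index map `χ = chartExponent s j` is INJECTIVE on indices of degree `≥ s` (so transported
presentations stay injectively labelled, as `degree_ge_of_mem_presentation` requires). [folklore] -/
theorem chartExponent_injOn (s : ℕ) (j : σ) {n n' : σ →₀ ℕ} (hn : s ≤ n.degree) (hn' : s ≤ n'.degree)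
    (h : chartExponent s j n = chartExponent s j n') : n = n' := by
  classical
  have hi : ∀ i, i ≠ j → n i = n' i := fun i hi => by
    have := congrArg (fun m => m i) h
    simp only [chartExponent_apply, if_neg hi] at this
    exact this
  have hj : n.degree - s = n'.degree - s := by
    have := congrArg (fun m => m j) h
    simp only [chartExponent_apply] at this
    exact this
  have herase : n.erase j = n'.erase j := by
    ext i
    by_cases hij : i = j
    · subst hij; rw [Finsupp.erase_same, Finsupp.erase_same]
    · rw [Finsupp.erase_ne hij, Finsupp.erase_ne hij, hi i hij]
  have hdeg : ∀ m : σ →₀ ℕ, m.degree = (m.erase j).degree + m j := fun m => by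
    conv_lhs => rw [← Finsupp.erase_add_single j m]
    rw [map_add, Finsupp.degree_single]
  have hjj : n j = n' j := by
    have h1 := hdeg n; have h2 := hdeg n'; rw [herase] at h1; omega
  rw [← Finsupp.erase_add_single j n, ← Finsupp.erase_add_single j n', herase, hjj]

end Transport

/-! ## §3 The free-chart law: the old frame coordinate becomes `y_z · h''`

Roles: the chart IS the sheared variable `z` (a FREE-CHART move), the centre `b` has `b_z = 0`.  The total transform of
the frame coordinate `y_z − ζ` is `y_z · (1 − cT_1 ζ)`; after translation the cofactor `h'' = translate b (1 − cT_1 ζ)`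
is the strict transform of the frame hypersurface at the new point — by §5 it vanishes there, and its `y_v`-coefficient
is the old one (`coeff_single_translate_chartTransform_one`), so the frame ROTATES: new walls `(kept, y_z)`, new free
variable `y_v`, new implicit jet from §4 applied to `h''`; the lost wall's coordinate `y_v` survives as the unit
`y_v + b_v` (exhibit §7). -/

section FreeChart

omit [Fintype σ] in
/-- **FREE-CHART LAW.** `translate b (θ_z (y_z − ζ)) = y_z · translate b (1 − chartTransform 1 z ζ)` for `ζ ∈ 𝔪`,
`b_z = 0`. [new] -/
theorem freeChart_law (z : σ) {ζ : MvPolynomial σ K} (hζ1 : (1 : ℕ∞) ≤ ordZero ζ) {b : σ → K} (hbz : b z = 0) :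
    PointBlowup.translate b (aeval (fun i => if i = z then X z else X z * X i) (X z - ζ)) =
      X z * PointBlowup.translate b ((1 : MvPolynomial σ K) - chartTransform 1 z ζ) := by
  have hθζ : (aeval fun i => if i = z then X z else X z * X i) ζ = X z ^ 1 * chartTransform 1 z ζ :=
    (X_pow_mul_chartTransform z hζ1).symm
  rw [map_sub, aeval_X, if_pos rfl, hθζ, pow_one, ← mul_one_sub, NearCut.translate_eq_aeval,
    NearCut.translate_eq_aeval, map_mul, aeval_X, hbz, C_0, add_zero]

end FreeChart

/-! ## §4 Implicit jets by the factor theorem (no derivatives, every characteristic)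

For `w ∈ K[y]` with `w(0) = 0` and `coeff_{e_v} w ≠ 0` (the frame hypersurface is a graph over the hyperplane `y_v = 0`
to first order) and every depth `D`: a `v`-free polynomial `ζ_D ∈ 𝔪` with `w(y_v := ζ_D) ∈ 𝔪^{D+1}` (Newton), the exact
factorisation `w = Q · (y_v − ζ) + w(y_v := ζ)` with `Q(0) = coeff_{e_v} w` (factor theorem), and uniqueness of jets
to the given depth.  These are the polynomial currency for Kollár's Weierstrass/implicit-function step
[Kollar2007, 2.56–2.59]: the frame coordinate is `y_v − ζ_D`, the "garbage" `w(y_v := ζ_D)` is `𝔪^{D+1}`-deep. -/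

section Jets

omit [Fintype σ] [DecidableEq σ] in
/-- A substitution fixing every variable but `z` fixes every `z`-free polynomial. [folklore] -/
theorem aeval_eq_self_of_varFree {z : σ} {f : σ → MvPolynomial σ K} (hf : ∀ i, i ≠ z → f i = X i)
    {P : MvPolynomial σ K} (hP : (∀ μ ∈ P.support, μ z = 0)) : aeval f P = P := by
  have hmem := mem_supported_of_varFree hP
  rw [supported_eq_range_rename, AlgHom.mem_range] at hmem
  obtain ⟨Q, rfl⟩ := hmem
  rw [aeval_rename]
  have hf' : ((f ∘ (Subtype.val : {i : σ | i ≠ z} → σ)) : {i : σ | i ≠ z} → MvPolynomial σ K) = X ∘ Subtype.val := by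
    funext i
    exact hf i i.2
  rw [hf', ← aeval_rename, aeval_X_left]
  rfl

/-- The substitution `y_v := ζ`. DEFINITION (support). -/
noncomputable def vsubst (v : σ) (ζ : MvPolynomial σ K) : MvPolynomial σ K →ₐ[K] MvPolynomial σ K :=
  aeval (Function.update X v ζ)

omit [Fintype σ] in
/-- `vsubst_X_self`: WallFrames (lens-5 g35) computation rule; docstring added by the writer (lint.docstring) [folklore] -/
theorem vsubst_X_self (v : σ) (ζ : MvPolynomial σ K) : vsubst v ζ (X v) = ζ := by
  unfold vsubst; rw [aeval_X, Function.update_self]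

omit [Fintype σ] in
/-- `vsubst_X_of_ne`: WallFrames (lens-5 g35) computation rule; docstring added by the writer (lint.docstring) [folklore] -/
theorem vsubst_X_of_ne {v i : σ} (h : i ≠ v) (ζ : MvPolynomial σ K) : vsubst v ζ (X i) = X i := by
  unfold vsubst; rw [aeval_X, Function.update_of_ne h]

omit [Fintype σ] in
/-- `vsubst_of_varFree`: WallFrames (lens-5 g35) computation rule; docstring added by the writer (lint.docstring) [folklore] -/
theorem vsubst_of_varFree {v : σ} (ζ : MvPolynomial σ K) {P : MvPolynomial σ K} (hP : (∀ μ ∈ P.support, μ v = 0)) :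
    vsubst v ζ P = P :=
  aeval_eq_self_of_varFree (fun i hi => by rw [Function.update_of_ne hi]) hP

omit [Fintype σ] in
/-- `varFree_vsubst`: WallFrames (lens-5 g35) computation rule; docstring added by the writer (lint.docstring) [folklore] -/
theorem varFree_vsubst {v : σ} {ζ : MvPolynomial σ K} (hζ : (∀ μ ∈ ζ.support, μ v = 0)) (P : MvPolynomial σ K) :
    (∀ μ ∈ (vsubst v ζ P).support, μ v = 0) := by
  refine varFree_aeval (fun i => ?_) P
  by_cases hi : i = v
  · subst hi; rw [Function.update_self]; exact hζ
  · rw [Function.update_of_ne hi]; exact varFree_X_of_ne hi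

omit [Fintype σ] in
/-- `le_ordZero_vsubst`: WallFrames (lens-5 g35) computation rule; docstring added by the writer (lint.docstring) [folklore] -/
theorem le_ordZero_vsubst {v : σ} {ζ : MvPolynomial σ K} (hζ1 : (1 : ℕ∞) ≤ ordZero ζ) (P : MvPolynomial σ K) :
    ordZero P ≤ ordZero (vsubst v ζ P) := by
  refine le_ordZero_aeval_of_forall (fun i => ?_) P
  by_cases hi : i = v
  · subst hi; rwa [Function.update_self]
  · rw [Function.update_of_ne hi, ordZero_X]

omit [Fintype σ] in
/-- `constantCoeff_vsubst`: WallFrames (lens-5 g35) computation rule; docstring added by the writer (lint.docstring) [folklore] -/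
theorem constantCoeff_vsubst {v : σ} {ζ : MvPolynomial σ K} (hζ1 : (1 : ℕ∞) ≤ ordZero ζ) (P : MvPolynomial σ K) :
    constantCoeff (vsubst v ζ P) = constantCoeff P := by
  refine constantCoeff_aeval_of_forall (fun i => ?_) P
  by_cases hi : i = v
  · subst hi; rw [Function.update_self]; exact (one_le_ordZero_iff ζ).mp hζ1
  · rw [Function.update_of_ne hi, constantCoeff_X]

omit [Fintype σ] in
/-- **FACTOR THEOREM in the variable `y_v`**: `w = Q · (y_v − ζ) + w(y_v := ζ)`. [folklore] -/
theorem exists_factor (v : σ) (ζ w : MvPolynomial σ K) :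
    ∃ Q : MvPolynomial σ K, w = Q * (X v - ζ) + vsubst v ζ w := by
  induction w using MvPolynomial.induction_on with
  | C c =>
    refine ⟨0, ?_⟩
    unfold vsubst
    rw [aeval_C, algebraMap_eq, zero_mul, zero_add]
  | add p q hp hq =>
    obtain ⟨Q₁, h₁⟩ := hp
    obtain ⟨Q₂, h₂⟩ := hq
    exact ⟨Q₁ + Q₂, by rw [map_add]; linear_combination h₁ + h₂⟩
  | mul_X p i hp =>
    obtain ⟨Q, h⟩ := hp
    by_cases hi : i = v
    · subst hi
      refine ⟨Q * X i + vsubst i ζ p, ?_⟩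
      rw [map_mul, vsubst_X_self]
      linear_combination (X i) * h
    · refine ⟨Q * X i, ?_⟩
      rw [map_mul, vsubst_X_of_ne hi]
      linear_combination (X i) * h

omit [Fintype σ] [DecidableEq σ] in
/-- The `e_v`-coefficient of a `v`-free polynomial vanishes. [folklore] -/
theorem coeff_single_eq_zero_of_varFree {v : σ} {P : MvPolynomial σ K} (hP : (∀ μ ∈ P.support, μ v = 0)) :
    coeff (Finsupp.single v 1) P = 0 := by
  by_contra h
  have := hP _ (mem_support_iff.mpr h)
  rw [Finsupp.single_eq_same] at this
  exact one_ne_zero this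

omit [Fintype σ] in
/-- `coeff_{e_v} (Q · ζ) = 0` for `ζ` `v`-free in `𝔪`. [folklore] -/
theorem coeff_single_mul_eq_zero {v : σ} {ζ : MvPolynomial σ K} (hζ : (∀ μ ∈ ζ.support, μ v = 0)) (hζ1 : (1 : ℕ∞) ≤ ordZero ζ)
    (Q : MvPolynomial σ K) : coeff (Finsupp.single v 1) (Q * ζ) = 0 := by
  classical
  rw [coeff_mul]
  refine Finset.sum_eq_zero fun ab hab => ?_
  rw [Finset.HasAntidiagonal.mem_antidiagonal] at hab
  by_cases hb : ab.2 ∈ ζ.support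
  · exfalso
    have hbv : ab.2 v = 0 := hζ _ hb
    have hb0 : ab.2 ≠ 0 := by
      rintro h0
      rw [h0, mem_support_iff] at hb
      exact hb ((one_le_ordZero_iff ζ).mp hζ1)
    apply hb0
    ext k
    have hk := congrArg (fun e : σ →₀ ℕ => e k) hab
    simp only [Finsupp.coe_add, Pi.add_apply] at hk
    by_cases hkv : k = v
    · subst hkv; simpa using hbv
    · rw [Finsupp.single_eq_of_ne hkv] at hk
      simp only [Finsupp.coe_zero, Pi.zero_apply]
      omega
  · rw [notMem_support_iff.mp hb, mul_zero]

omit [Fintype σ] in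
/-- **`Q(0) = coeff_{e_v} w`** in the factorisation `w = Q (y_v − ζ) + w(y_v := ζ)` (`ζ` `v`-free in `𝔪`): the implicit
function nondegeneracy `∂w/∂y_v (0) ≠ 0` makes `Q` a unit. [folklore] -/
theorem constantCoeff_factor {v : σ} {ζ w Q : MvPolynomial σ K} (hζ : (∀ μ ∈ ζ.support, μ v = 0)) (hζ1 : (1 : ℕ∞) ≤ ordZero ζ)
    (h : w = Q * (X v - ζ) + vsubst v ζ w) : constantCoeff Q = coeff (Finsupp.single v 1) w := by
  classical
  have hc := congrArg (coeff (Finsupp.single v 1)) h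
  rw [coeff_add, mul_sub, coeff_sub, coeff_single_mul_eq_zero hζ hζ1 Q,
    coeff_single_eq_zero_of_varFree (varFree_vsubst hζ w), coeff_mul_X', if_pos (by simp), sub_zero, add_zero,
    tsub_self] at hc
  exact hc.symm

-- writer g14: `le_ordZero_sub_homogeneousComponent` deleted — dedup.landed twin `Hauser2010.succ_le_ordZero_sub_homogeneousComponent` (Literature/…/OrdZeroBasics); use sites in WallFrames4/5/9 cite the landed name.

end Jets

end Summit.ResolutionOfSingularities.ResolutionOfSingularities.Theorems.WallFrames
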